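import Summits.Ventures.PercRepro.Night2BasisLoaded

/-!
# night-2: a loaded target is a line-subset plus at most five points

A loaded target `T` (`dload (dshGT2) T ≠ 0`) is `insert x Q` or `insert x (insert x' Q)` for a lossy big pair with
`Q = insert z B` (`exists_pair_of_dload_ne_zero`); `Q ∖ K` has exactly three coloops and the remaining points `R` have
rank `2` (`card_coloops_eq_three_of_loss_ne_zero`, the rank formula), so `T ∖ K = R ∪ (≤ 5 points)` with `R` on a line
(`loaded_target_structure`) — the shape of the targets whose floor in `vType` is `0` (paper NIGHT-2-g31 §3.3 (1)).
-/

namespace PercRepro.Shadow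

open PercRepro.ThmH PercRepro.PerFlat

variable {α : Type*} [DecidableEq α] {M : Matroid α} [M.Finite] {G : Finset α}

/-- **A loaded target is a rank-`2` set plus at most five points (off `K`).** -/
theorem loaded_target_structure (hG : G ∈ flatsQ M (5 + 1)) (hd : (gr M \ G).card = 2)
    (hk : kColoops M G = 1) (hs : ∀ e ∈ gr M, ∀ f ∈ gr M, e ≠ f → rkN M {e, f} = 2)
    (hl : ∀ e ∈ gr M, M.Indep {e}) {T : Finset α} (hTG : T ⊆ G)
    (hne : dload M 5 G (bigP M G) (dshGT2 M 5 G) T ≠ 0) :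
    ∃ R ⊆ T \ coloops M G, rkN M R = 2 ∧ 3 ≤ R.card ∧ ((T \ coloops M G) \ R).card ≤ 5 := by
  have hd' : (gr M \ G).card ≤ 5 := by omega
  have hGg : G ⊆ gr M := (mem_flatsQ.1 hG).1
  obtain ⟨B, hB, hbig, z, hz, hloss, hcase⟩ := exists_pair_of_dload_ne_zero hG hd hk hs hl hne
  have hBG : B ⊆ G := subset_G_of_mem_thinMembers hB
  have hzG : z ∈ G := (Finset.mem_sdiff.1 hz).1
  have hQG : insert z B ⊆ G := Finset.insert_subset hzG hBG
  have hKQ : coloops M G ⊆ insert z B :=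
    (coloops_subset_of_mem_thinMembers hG hd' hB).trans (Finset.subset_insert _ _)
  set Q' := insert z B \ coloops M G with hQ'
  have hQ'g : Q' ⊆ gr M := Finset.sdiff_subset.trans (hQG.trans hGg)
  have h3 := card_coloops_eq_three_of_loss_ne_zero hG hd hk hs hl hB hbig hz hloss
  rw [← hQ'] at h3
  have hrQ' : rkN M Q' = 5 := by
    have h1 := rkN_eq_rkN_sdiff_add_one hG hk (S := insert z B) hQG (Finset.Subset.refl _) hKQ
    rw [rkN_insert_of_notMem_clF (hGg hzG) (Finset.mem_sdiff.1 hz).2, rkN_eq_five_of_mem_thinMembers hB,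
      ← hQ'] at h1
    omega
  have hcQ' : 6 ≤ Q'.card := by
    have hzB : z ∉ B := fun h => (Finset.mem_sdiff.1 hz).2 (subset_clF_of_subset_gr (hBG.trans hGg) h)
    have hzK : z ∉ coloops M G := fun h => hzB (coloops_subset_of_mem_thinMembers hG hd' hB h)
    rw [hQ', Finset.insert_sdiff_of_notMem _ hzK, Finset.card_insert_of_notMem (fun h => hzB (Finset.mem_sdiff.1 h).1)]
    omega
  set R := Q' \ coloops M Q' with hR
  have hrR : rkN M R = 2 := by
    have := rkN_sdiff_add_card_of_subset_coloops (M := M) hQ'g (T := coloops M Q') (Finset.Subset.refl _)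
    rw [h3, hrQ', ← hR] at this
    omega
  have hcR : 3 ≤ R.card := by
    have := Finset.card_sdiff_add_card_eq_card (show coloops M Q' ⊆ Q' from fun a ha => (mem_coloops.1 ha).1)
    rw [h3, ← hR] at this
    omega
  -- `Q ⊆ T` and `T ∖ K ⊆ Q' ∪ {x, x'}`
  have hQT : insert z B ⊆ T := by
    rcases hcase with ⟨x, -, rfl⟩ | ⟨p, -, rfl⟩
    · exact Finset.subset_insert _ _
    · exact (Finset.subset_insert _ _).trans (Finset.subset_insert _ _)
  have hRT : R ⊆ T \ coloops M G :=
    Finset.sdiff_subset.trans (Finset.sdiff_subset_sdiff hQT (Finset.Subset.refl _))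
  refine ⟨R, hRT, hrR, hcR, ?_⟩
  -- the points of `T ∖ K` off `R` are the three coloops and at most two more
  have hsub : (T \ coloops M G) \ R ⊆ coloops M Q' ∪ ((T \ coloops M G) \ Q') := by
    intro a ha
    rw [Finset.mem_sdiff] at ha
    rw [Finset.mem_union, Finset.mem_sdiff]
    by_cases haQ : a ∈ Q'
    · left
      by_contra hnot
      exact ha.2 (Finset.mem_sdiff.2 ⟨haQ, hnot⟩)
    · exact Or.inr ⟨ha.1, haQ⟩
  have hextra : ((T \ coloops M G) \ Q').card ≤ 2 := by
    have hsub2 : (T \ coloops M G) \ Q' ⊆ T \ insert z B := by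
      intro a ha
      rw [Finset.mem_sdiff] at ha ⊢
      refine ⟨(Finset.mem_sdiff.1 ha.1).1, fun h => ha.2 ?_⟩
      exact Finset.mem_sdiff.2 ⟨h, (Finset.mem_sdiff.1 ha.1).2⟩
    refine (Finset.card_le_card hsub2).trans ?_
    rcases hcase with ⟨x, -, rfl⟩ | ⟨p, -, rfl⟩
    · calc (insert x (insert z B) \ insert z B).card ≤ ({x} : Finset α).card := by
            apply Finset.card_le_card
            intro a ha
            rw [Finset.mem_sdiff, Finset.mem_insert] at ha
            rw [Finset.mem_singleton]
            rcases ha.1 with h | h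
            · exact h
            · exact absurd h ha.2
        _ ≤ 2 := by simp
    · calc (insert p.1 (insert p.2 (insert z B)) \ insert z B).card ≤ ({p.1, p.2} : Finset α).card := by
            apply Finset.card_le_card
            intro a ha
            rw [Finset.mem_sdiff, Finset.mem_insert, Finset.mem_insert] at ha
            rw [Finset.mem_insert, Finset.mem_singleton]
            rcases ha.1 with h | h | h
            · exact Or.inl h
            · exact Or.inr h
            · exact absurd h ha.2
        _ ≤ 2 := Finset.card_le_two
  calc ((T \ coloops M G) \ R).card ≤ (coloops M Q' ∪ ((T \ coloops M G) \ Q')).card := Finset.card_le_card hsub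
    _ ≤ (coloops M Q').card + ((T \ coloops M G) \ Q').card := Finset.card_union_le _ _
    _ ≤ 5 := by omega

end PercRepro.Shadow
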